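import Summits.AtomisticToContinuum.HydrodynamicLimit.Theorems.AntiMazurCoboundariesCorrectorPressureDecayKiferCanonicalLocalLimitBasics
import Summits.AtomisticToContinuum.HydrodynamicLimit.Theorems.AntiMazurCoboundariesCorrectorPressureDecayKiferCanonicalLocalLimitTranslation
import Summits.AtomisticToContinuum.HydrodynamicLimit.Theorems.AntiMazurCoboundariesCorrectorPressureDecayKiferEntropyLsc
import Summits.AtomisticToContinuum.HydrodynamicLimit.Theorems.AntiMazurCoboundariesCorrectorPressureDecayKiferGibbsMixtureWallCampbell
import Literature.MathematicalPhysics.KineticTheory.HardSphereUniformGas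

/-!
# The Gibbs-mixture wall, core IV: the marks of a canonical local limit are Maxwellian given the positions
# (line `FirstLemma`, crux stmt-AtomisticToContinuum-14135 `AntiMazurCoboundaries.CorrectorPressureDecay`; lead seat c9)

Fourth helper file of the registered stub `gibbsMixtureWall_holds : GibbsMixtureWall` (…KiferWallMacroErgodic.lean),
namespace `Summit.AtomisticToContinuum.HydrodynamicLimit.Theorems.KiferCompactification`: the reference-side half of
piece (P3) of the lead's design. Under the x-averaged blown-up canonical law `canonicalBlowUpLaw σ a θ u₀ N Φ` the
velocities are i.i.d. `N(u₀, θI)` and independent of the positions (`localGibbsMeasure_rung0_eq_map`); hence for every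
measurable `f : ℝ³ → ℝ` with `∫ e^f dN(u₀, θI) ≤ 1` and every window `Λ`, the multiplicative mark functional
`e^{F_Λ}`, `F_Λ(ω) = Σ_{(q,v) ∈ ω, q ∈ Λ} f(v)`, has mean `≤ 1` (`gml_lintegral_exp_markSum_canonicalBlowUp_le`: blow up,
throw away the null set off the hard-sphere domain where the labelled blow-up is injective (`injective_blowUpPoint`), so
that `F_Λ` is the label sum over the particles blown into `Λ` — a set of labels determined by the positions — and
integrate the velocities out label by label, `lintegral_fintype_prod_eq_prod'`). The bound passes to every canonical
local limit `G` along the TRUNCATED functionals `exp(max(min(F_Λ, M), -M)) ≤ e^{F_Λ} + e^{-M}`, which are bounded and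
measurable, by setwise convergence of the window laws (`tendsto_integral_of_forall_tendsto_measure`):

  `∫ exp(max(min(F_Λ, M), -M)) d(windowLaw Λ G) ≤ 1 + e^{-M}`   (`gml_integral_exp_trunc_markSum_windowLaw_le`, MAIN)

for `Λ` a centred box, `0 < σ ≤ 1/2`, `a, θ > 0`. Here `F_Λ` is written as the difference of the `ℝ≥0∞`-valued window
sums of `f⁺` and `f⁻` read back in `ℝ` (a measurable version of the real window sum, equal to it whenever finitely many
particles lie above `Λ`). This is the input "the marks of `G` are `N(u₀, θI)` given the positions" of the entropy floor
`KL(κ_Λ ‖ G_Λ) ≥ E_κ[N_Λ] · KL(N(u, β⁻¹I) ‖ N(u₀, θI))` (Donsker–Varadhan with the test function `F_Λ`, `f = log` of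
the ratio of the two Maxwellians; next file).
-/

noncomputable section

open MeasureTheory ProbabilityTheory Set Filter Topology Function
open scoped ENNReal

namespace Summit.AtomisticToContinuum.HydrodynamicLimit.Theorems.KiferCompactification

open Literature.MathematicalPhysics.KineticTheory (T3 V3 hsDiameter hsDiameter_pos localGibbsLaw localGibbsLaw_eq
  localGibbsMeasure_rung0_eq_map blowUp blowUpPoint mem_blowUp gaussMeasure zipConfig zipConfig_apply measurable_zipConfig
  zipConfig_mem_hardSphereDomain_iff posGibbsMeasure isProbabilityMeasure_posGibbsMeasure isProbabilityMeasure_localGibbsLaw)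
open Literature.MathematicalPhysics.KineticTheory.PointProcess (windowLaw windowRestrict centredBox isProbabilityMeasure_windowLaw
  measurable_windowRestrict)
open Literature.Analysis.FluidPDE (HardSphereFlow Config hardSphereDomain windowSum particlesIn particlesIn_eq)
open Literature.Analysis.FunctionSpaces (PointConfig)

/-! ## Window sums: restriction invariance, blow-ups, truncation -/

/-- The window sum only sees the window: `windowSum (windowRestrict Λ ω) Λ g = windowSum ω Λ g`. -/
theorem gml_windowSum_windowRestrict (Λ : Set V3) (ω : PointConfig (V3 × V3)) (g : V3 × V3 → ℝ≥0∞) :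
    windowSum (windowRestrict Λ ω) Λ g = windowSum ω Λ g := by
  have hset : particlesIn (windowRestrict Λ ω) Λ = particlesIn ω Λ := by
    ext p
    simp only [particlesIn_eq, Literature.MathematicalPhysics.KineticTheory.PointProcess.windowRestrict, mem_inter_iff,
      mem_preimage, Literature.Analysis.FunctionSpaces.PointConfig.coe_eq_carrier, PointConfig.restrict]
    tauto
  unfold windowSum
  rw [tsum_congr_set_coe g hset]

/-- Truncation costs at most `e^{-M}`: `exp(max(min(s, M), -M)) ≤ e^s + e^{-M}`. -/
theorem gml_exp_trunc_le (s M : ℝ) : Real.exp (max (min s M) (-M)) ≤ Real.exp s + Real.exp (-M) := by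
  rcases le_total (min s M) (-M) with h | h
  · rw [max_eq_right h]
    linarith [Real.exp_pos s]
  · rw [max_eq_left h]
    linarith [Real.exp_pos (-M), Real.exp_le_exp.2 (min_le_left s M)]

/-- The truncated exponential is bounded by `e^{M}` (`M ≥ 0`). -/
theorem gml_abs_exp_trunc_le (s : ℝ) {M : ℝ} (hM : 0 ≤ M) : |Real.exp (max (min s M) (-M))| ≤ Real.exp M := by
  rw [abs_of_pos (Real.exp_pos _)]
  exact Real.exp_le_exp.2 (max_le (min_le_right _ _) (by linarith))

/-- **Window sums of a blown-up hard-sphere configuration are label sums** over the particles blown into the window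
(the labelled blow-up is injective on the hard-sphere domain, `ε > 0`). -/
theorem gml_windowSum_blowUp_eq_sum {ε : ℝ} (hε : 0 < ε) (x : T3) {K : ℕ} {z : Config K (Fin 3) T3}
    (hz : z ∈ hardSphereDomain (Literature.Analysis.FluidPDE.Torus.geometry (Fin 3)) K ε) (Λ : Set V3)
    (g : V3 × V3 → ℝ≥0∞) [DecidablePred fun i : Fin K => (blowUpPoint ε x (z i)).1 ∈ Λ] :
    windowSum (blowUp ε x z) Λ g = ∑ i ∈ Finset.univ.filter (fun i => (blowUpPoint ε x (z i)).1 ∈ Λ), g (blowUpPoint ε x (z i)) := by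
  have hinj := injective_blowUpPoint hε x hz
  set I : Set (Fin K) := {i | (blowUpPoint ε x (z i)).1 ∈ Λ} with hI
  have hset : particlesIn (blowUp ε x z) Λ = (fun i => blowUpPoint ε x (z i)) '' I := by
    ext p
    simp only [particlesIn_eq, mem_inter_iff, mem_preimage, Literature.Analysis.FunctionSpaces.PointConfig.coe_eq_carrier,
      PointConfig.mem_carrier, mem_blowUp, mem_image, hI, mem_setOf_eq]
    constructor
    · rintro ⟨⟨i, rfl⟩, hp⟩
      exact ⟨i, hp, rfl⟩
    · rintro ⟨i, hi, rfl⟩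
      exact ⟨⟨i, rfl⟩, hi⟩
  have hIfin : I = ↑(Finset.univ.filter fun i => (blowUpPoint ε x (z i)).1 ∈ Λ) := by
    ext i
    simp [hI]
  unfold windowSum
  rw [tsum_congr_set_coe g hset, tsum_image g hinj.injOn, tsum_congr_set_coe (fun i => g (blowUpPoint ε x (z i))) hIfin]
  exact Finset.tsum_subtype _ fun i => g (blowUpPoint ε x (z i))

/-! ## The mark functional of a blown-up canonical configuration: integrating out the velocities -/

/-- **Integrating out the velocities label by label.** For positions `xs` in the positional hard-core domain, a base
point `x`, and measurable `f` with `∫ e^f dN(u₀, θI) ≤ 1`: the `N(u₀,θI)^{⊗K}`-mean over the velocities of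
`exp F_Λ(blowUp ε x (zip(xs, vs)))` is `≤ 1` (it is the product over the labels blown into `Λ` of `∫ e^f dN(u₀,θI)`). -/
theorem gml_lintegral_exp_markSum_zip_le {ε : ℝ} (hε : 0 < ε) (x : T3) {K : ℕ} {xs : Fin K → T3}
    (hxs : xs ∈ Literature.MathematicalPhysics.KineticTheory.posDomain ε K) (Λ : Set V3) (u₀ : V3) (θ : ℝ)
    {f : V3 → ℝ} (hfm : Measurable f) (hf1 : ∫⁻ v, ENNReal.ofReal (Real.exp (f v)) ∂(gaussMeasure u₀ θ) ≤ 1) :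
    ∫⁻ vs, ENNReal.ofReal (Real.exp ((windowSum (blowUp ε x (zipConfig (xs, vs))) Λ (fun p => ENNReal.ofReal (f p.2))).toReal -
        (windowSum (blowUp ε x (zipConfig (xs, vs))) Λ (fun p => ENNReal.ofReal (-f p.2))).toReal))
      ∂(Measure.pi fun _ : Fin K => gaussMeasure u₀ θ) ≤ 1 := by
  classical
  -- the set of labels blown into `Λ` depends on the positions only
  set I : Finset (Fin K) := Finset.univ.filter fun i => (ε⁻¹ • Literature.Analysis.FluidPDE.Torus.reprSym (xs i - x)) ∈ Λ
    with hI
  have hfilter : ∀ vs : Fin K → V3, (Finset.univ.filter fun i => (blowUpPoint ε x (zipConfig (xs, vs) i)).1 ∈ Λ) = I := by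
    intro vs
    simp only [hI, blowUpPoint, zipConfig_apply]
  -- on the hard-core domain the mark functional is the label sum, and its exponential the label product
  have hexp : ∀ vs : Fin K → V3, ENNReal.ofReal (Real.exp
      ((windowSum (blowUp ε x (zipConfig (xs, vs))) Λ (fun p => ENNReal.ofReal (f p.2))).toReal -
        (windowSum (blowUp ε x (zipConfig (xs, vs))) Λ (fun p => ENNReal.ofReal (-f p.2))).toReal)) =
      ∏ i, (if i ∈ I then ENNReal.ofReal (Real.exp (f (vs i))) else 1) := by
    intro vs
    have hz : zipConfig (xs, vs) ∈ hardSphereDomain (Literature.Analysis.FluidPDE.Torus.geometry (Fin 3)) K ε :=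
      (zipConfig_mem_hardSphereDomain_iff ε xs vs).2 hxs
    rw [gml_windowSum_blowUp_eq_sum hε x hz Λ, gml_windowSum_blowUp_eq_sum hε x hz Λ, hfilter vs,
      ENNReal.toReal_sum fun i _ => ENNReal.ofReal_ne_top, ENNReal.toReal_sum fun i _ => ENNReal.ofReal_ne_top,
      ← Finset.sum_sub_distrib]
    simp only [blowUpPoint, zipConfig_apply, ENNReal.toReal_ofReal', max_zero_sub_max_neg_zero_eq_self, Real.exp_sum]
    rw [ENNReal.ofReal_prod_of_nonneg fun i _ => (Real.exp_pos _).le, Finset.prod_ite_mem, Finset.univ_inter]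
  simp_rw [hexp]
  have hmeas : ∀ i : Fin K, Measurable fun v : V3 => (if i ∈ I then ENNReal.ofReal (Real.exp (f v)) else 1) := by
    intro i
    by_cases hi : i ∈ I
    · simp only [hi, if_true]
      exact (Real.measurable_exp.comp hfm).ennreal_ofReal
    · simp only [hi, if_false]
      exact measurable_const
  have hprod := Literature.MathematicalPhysics.KineticTheory.lintegral_fintype_prod_eq_prod' (fun _ : Fin K => gaussMeasure u₀ θ)
    (f := fun i v => if i ∈ I then ENNReal.ofReal (Real.exp (f v)) else 1) hmeas
  rw [show (∫⁻ vs : Fin K → V3, ∏ i, (if i ∈ I then ENNReal.ofReal (Real.exp (f (vs i))) else 1)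
    ∂(Measure.pi fun _ : Fin K => gaussMeasure u₀ θ)) = _ from hprod]
  refine Finset.prod_le_one' fun i _ => ?_
  by_cases hi : i ∈ I
  · simp only [hi, if_true]
    exact hf1
  · simp only [hi, if_false, lintegral_const, measure_univ, mul_one, le_refl]

/-- The mark functional `exp F_Λ` (in `ℝ≥0∞`) is a measurable function of the configuration. -/
theorem gml_measurable_exp_markSum {Λ : Set V3} (hΛ : MeasurableSet Λ) {f : V3 → ℝ} (hfm : Measurable f) :
    Measurable fun ω : PointConfig (V3 × V3) => ENNReal.ofReal (Real.exp
      ((windowSum ω Λ (fun p => ENNReal.ofReal (f p.2))).toReal - (windowSum ω Λ (fun p => ENNReal.ofReal (-f p.2))).toReal)) := by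
  have h1 : Measurable fun v => ENNReal.ofReal (f v) := hfm.ennreal_ofReal
  have h2 : Measurable fun v => ENNReal.ofReal (-f v) := hfm.neg.ennreal_ofReal
  exact (Real.measurable_exp.comp ((gmc_measurable_windowSum hΛ h1).ennreal_toReal.sub
    (gmc_measurable_windowSum hΛ h2).ennreal_toReal)).ennreal_ofReal

/-- The truncated mark functional `exp(max(min(F_Λ, M), -M))` is a measurable function of the configuration. -/
theorem gml_measurable_exp_trunc_markSum {Λ : Set V3} (hΛ : MeasurableSet Λ) {f : V3 → ℝ} (hfm : Measurable f) (M : ℝ) :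
    Measurable fun ω : PointConfig (V3 × V3) => Real.exp (max (min
      ((windowSum ω Λ (fun p => ENNReal.ofReal (f p.2))).toReal - (windowSum ω Λ (fun p => ENNReal.ofReal (-f p.2))).toReal)
        M) (-M)) := by
  have h1 : Measurable fun v => ENNReal.ofReal (f v) := hfm.ennreal_ofReal
  have h2 : Measurable fun v => ENNReal.ofReal (-f v) := hfm.neg.ennreal_ofReal
  exact Real.measurable_exp.comp ((((gmc_measurable_windowSum hΛ h1).ennreal_toReal.sub
    (gmc_measurable_windowSum hΛ h2).ennreal_toReal).min measurable_const).max measurable_const)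

/-- **Under the x-averaged blown-up canonical law the mark functional has mean at most one**:
`∫⁻ exp F_Λ d(canonicalBlowUpLaw σ a θ u₀ K Φ) ≤ 1` for measurable `f` with `∫ e^f dN(u₀, θI) ≤ 1` (`0 < σ ≤ 1/2`,
`a, θ > 0`; blow up, discard the null set off the hard-sphere domain, integrate the velocities out). -/
theorem gml_lintegral_exp_markSum_canonicalBlowUp_le {σ a θ : ℝ} (u₀ : V3) (hσ : 0 < σ) (hσ2 : σ ≤ 1 / 2) (ha : 0 < a)
    (hθ : 0 < θ) (K : ℕ) (Φ : HardSphereFlow (Literature.Analysis.FluidPDE.Torus.geometry (Fin 3)) (hsDiameter σ K) (K + 1))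
    {Λ : Set V3} (hΛ : MeasurableSet Λ) {f : V3 → ℝ} (hfm : Measurable f)
    (hf1 : ∫⁻ v, ENNReal.ofReal (Real.exp (f v)) ∂(gaussMeasure u₀ θ) ≤ 1) :
    ∫⁻ ω, ENNReal.ofReal (Real.exp ((windowSum ω Λ (fun p => ENNReal.ofReal (f p.2))).toReal -
        (windowSum ω Λ (fun p => ENNReal.ofReal (-f p.2))).toReal)) ∂(canonicalBlowUpLaw σ a θ u₀ K Φ) ≤ 1 := by
  have hε : 0 < hsDiameter σ K := hsDiameter_pos hσ K
  set H : PointConfig (V3 × V3) → ℝ≥0∞ := fun ω => ENNReal.ofReal (Real.exp ((windowSum ω Λ (fun p => ENNReal.ofReal (f p.2))).toReal -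
    (windowSum ω Λ (fun p => ENNReal.ofReal (-f p.2))).toReal)) with hH
  have hHm : Measurable H := gml_measurable_exp_markSum hΛ hfm
  haveI : IsProbabilityMeasure (volume : Measure T3) := by rw [volume_pi]; infer_instance
  haveI := isProbabilityMeasure_localGibbsLaw (a₀ := fun _ => a) (θ₀ := fun _ => θ) (u₀ := fun _ => u₀)
    continuous_const continuous_const continuous_const (fun _ => ha) (fun _ => hθ) hσ2 K Φ
  haveI := isProbabilityMeasure_posGibbsMeasure (a₀ := fun _ : T3 => a) continuous_const (fun _ => ha) hσ2 K
  -- the hard-sphere domain and its indicator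
  set D : Set (Config (K + 1) (Fin 3) T3) := hardSphereDomain (Literature.Analysis.FluidPDE.Torus.geometry (Fin 3)) (K + 1) (hsDiameter σ K)
    with hDdef
  have hDm : MeasurableSet D :=
    Literature.Analysis.FluidPDE.measurableSet_hardSphereDomain _ Literature.Analysis.FluidPDE.Torus.measurable_geometry_sepVec _ _
  -- per base point, the mean over the canonical law is at most one
  have hx : ∀ x : T3, ∫⁻ z, H (blowUp (hsDiameter σ K) x z) ∂(localGibbsLaw σ (fun _ => a) (fun _ => u₀) (fun _ => θ) K Φ) ≤ 1 := by
    intro x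
    have hFm : Measurable fun z : Config (K + 1) (Fin 3) T3 => H (blowUp (hsDiameter σ K) x z) := by
      have h1 : Measurable fun z : Config (K + 1) (Fin 3) T3 => ((x, z) : T3 × Config (K + 1) (Fin 3) T3) := measurable_prodMk_left
      have h := (measurable_blowUp (hsDiameter σ K) (K + 1)).comp h1
      exact hHm.comp h
    have hae := ae_mem_hardSphereDomain_localGibbsLaw σ (fun _ => a) (fun _ => θ) (fun _ => u₀) K Φ
    calc ∫⁻ z, H (blowUp (hsDiameter σ K) x z) ∂(localGibbsLaw σ (fun _ => a) (fun _ => u₀) (fun _ => θ) K Φ)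
        = ∫⁻ z, D.indicator (fun z => H (blowUp (hsDiameter σ K) x z)) z ∂(localGibbsLaw σ (fun _ => a) (fun _ => u₀) (fun _ => θ) K Φ) := by
          refine lintegral_congr_ae (hae.mono fun z hz => ?_)
          rw [indicator_of_mem hz]
      _ = ∫⁻ xs, ∫⁻ vs, D.indicator (fun z => H (blowUp (hsDiameter σ K) x z)) (zipConfig (xs, vs))
            ∂(Measure.pi fun _ : Fin (K + 1) => gaussMeasure u₀ θ) ∂(posGibbsMeasure (fun _ : T3 => a) (hsDiameter σ K) (K + 1)) := by
          have hz : MeasurableEmbedding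
              (zipConfig : (Fin (K + 1) → T3) × (Fin (K + 1) → V3) → Config (K + 1) (Fin 3) T3) :=
            (MeasurableEquiv.arrowProdEquivProdArrow T3 V3 (Fin (K + 1))).symm.measurableEmbedding
          rw [localGibbsLaw_eq, localGibbsMeasure_rung0_eq_map σ ha.le hθ u₀ K, hz.lintegral_map]
          exact lintegral_prod _ ((hFm.indicator hDm).comp measurable_zipConfig).aemeasurable
      _ ≤ ∫⁻ _, 1 ∂(posGibbsMeasure (fun _ : T3 => a) (hsDiameter σ K) (K + 1)) := by
          refine lintegral_mono fun xs => ?_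
          by_cases hxs : xs ∈ Literature.MathematicalPhysics.KineticTheory.posDomain (hsDiameter σ K) (K + 1)
          · calc ∫⁻ vs, D.indicator (fun z => H (blowUp (hsDiameter σ K) x z)) (zipConfig (xs, vs))
                  ∂(Measure.pi fun _ : Fin (K + 1) => gaussMeasure u₀ θ)
                = ∫⁻ vs, H (blowUp (hsDiameter σ K) x (zipConfig (xs, vs))) ∂(Measure.pi fun _ : Fin (K + 1) => gaussMeasure u₀ θ) :=
                  lintegral_congr fun vs => indicator_of_mem ((zipConfig_mem_hardSphereDomain_iff (hsDiameter σ K) xs vs).2 hxs) _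
              _ ≤ 1 := gml_lintegral_exp_markSum_zip_le hε x hxs Λ u₀ θ hfm hf1
          · calc ∫⁻ vs, D.indicator (fun z => H (blowUp (hsDiameter σ K) x z)) (zipConfig (xs, vs))
                  ∂(Measure.pi fun _ : Fin (K + 1) => gaussMeasure u₀ θ)
                = ∫⁻ _, 0 ∂(Measure.pi fun _ : Fin (K + 1) => gaussMeasure u₀ θ) :=
                  lintegral_congr fun vs =>
                    indicator_of_notMem (fun h => hxs ((zipConfig_mem_hardSphereDomain_iff (hsDiameter σ K) xs vs).1 h)) _
              _ ≤ 1 := by rw [lintegral_zero]; exact zero_le_one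
      _ = 1 := by rw [lintegral_const, measure_univ, mul_one]
  -- average over the base point
  unfold canonicalBlowUpLaw
  have hHb : Measurable fun p : T3 × Config (K + 1) (Fin 3) T3 => H (blowUp (hsDiameter σ K) p.1 p.2) :=
    hHm.comp (measurable_blowUp (hsDiameter σ K) (K + 1))
  rw [lintegral_map hHm (measurable_blowUp (hsDiameter σ K) (K + 1)),
    lintegral_prod (fun p : T3 × Config (K + 1) (Fin 3) T3 => H (blowUp (hsDiameter σ K) p.1 p.2)) hHb.aemeasurable]
  calc ∫⁻ x, ∫⁻ z, H (blowUp (hsDiameter σ K) x z) ∂(localGibbsLaw σ (fun _ => a) (fun _ => u₀) (fun _ => θ) K Φ) ∂(volume : Measure T3)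
      ≤ ∫⁻ _, 1 ∂(volume : Measure T3) := lintegral_mono hx
    _ = 1 := by rw [lintegral_const, measure_univ, mul_one]

/-- **The truncated mark functional under the window law of the blown-up canonical law**:
`∫ exp(max(min(F_Λ, M), -M)) d(windowLaw Λ (canonicalBlowUpLaw σ a θ u₀ K Φ)) ≤ 1 + e^{-M}`. -/
theorem gml_integral_exp_trunc_markSum_canonicalBlowUp_le {σ a θ : ℝ} (u₀ : V3) (hσ : 0 < σ) (hσ2 : σ ≤ 1 / 2)
    (ha : 0 < a) (hθ : 0 < θ) (K : ℕ)
    (Φ : HardSphereFlow (Literature.Analysis.FluidPDE.Torus.geometry (Fin 3)) (hsDiameter σ K) (K + 1))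
    {Λ : Set V3} (hΛ : MeasurableSet Λ) {f : V3 → ℝ} (hfm : Measurable f)
    (hf1 : ∫⁻ v, ENNReal.ofReal (Real.exp (f v)) ∂(gaussMeasure u₀ θ) ≤ 1) (M : ℝ) :
    ∫ ω, Real.exp (max (min ((windowSum ω Λ (fun p => ENNReal.ofReal (f p.2))).toReal -
        (windowSum ω Λ (fun p => ENNReal.ofReal (-f p.2))).toReal) M) (-M)) ∂(windowLaw Λ (canonicalBlowUpLaw σ a θ u₀ K Φ)) ≤
      1 + Real.exp (-M) := by
  set P := canonicalBlowUpLaw σ a θ u₀ K Φ with hP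
  haveI : IsProbabilityMeasure P := by rw [hP]; unfold canonicalBlowUpLaw; exact isProbabilityMeasure_canonicalBlowUp u₀ hσ2 ha hθ K Φ
  set F : PointConfig (V3 × V3) → ℝ := fun ω => (windowSum ω Λ (fun p => ENNReal.ofReal (f p.2))).toReal -
    (windowSum ω Λ (fun p => ENNReal.ofReal (-f p.2))).toReal with hF
  have hψm : Measurable fun ω => Real.exp (max (min (F ω) M) (-M)) := gml_measurable_exp_trunc_markSum hΛ hfm M
  have hEm : Measurable fun ω => ENNReal.ofReal (Real.exp (F ω)) := gml_measurable_exp_markSum hΛ hfm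
  -- the window law sees the same functional
  have hwin : ∫ ω, Real.exp (max (min (F ω) M) (-M)) ∂(windowLaw Λ P) = ∫ ω, Real.exp (max (min (F ω) M) (-M)) ∂P := by
    rw [Literature.MathematicalPhysics.KineticTheory.PointProcess.windowLaw, integral_map (measurable_windowRestrict hΛ).aemeasurable
      hψm.aestronglyMeasurable]
    refine integral_congr_ae (Eventually.of_forall fun ω => ?_)
    simp only [hF, gml_windowSum_windowRestrict]
  rw [hwin]
  -- `e^F` is integrable with mean at most one
  have hlin : ∫⁻ ω, ENNReal.ofReal (Real.exp (F ω)) ∂P ≤ 1 :=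
    gml_lintegral_exp_markSum_canonicalBlowUp_le u₀ hσ hσ2 ha hθ K Φ hΛ hfm hf1
  have hEi : Integrable (fun ω => Real.exp (F ω)) P := by
    refine ⟨(Real.measurable_exp.comp ?_).aestronglyMeasurable, ?_⟩
    · exact ((gmc_measurable_windowSum hΛ hfm.ennreal_ofReal).ennreal_toReal.sub
        (gmc_measurable_windowSum hΛ (show Measurable fun v => ENNReal.ofReal (-f v) from hfm.neg.ennreal_ofReal)).ennreal_toReal)
    · rw [hasFiniteIntegral_iff_ofReal (ae_of_all _ fun ω => (Real.exp_pos _).le)]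
      exact hlin.trans_lt ENNReal.one_lt_top
  have hψi : Integrable (fun ω => Real.exp (max (min (F ω) M) (-M))) P := by
    refine Integrable.of_bound hψm.aestronglyMeasurable (Real.exp |M|) (ae_of_all _ fun ω => ?_)
    rw [Real.norm_eq_abs, abs_of_pos (Real.exp_pos _)]
    exact Real.exp_le_exp.2 (max_le ((min_le_right _ _).trans (le_abs_self M)) (by linarith [neg_abs_le M]))
  calc ∫ ω, Real.exp (max (min (F ω) M) (-M)) ∂P ≤ ∫ ω, (Real.exp (F ω) + Real.exp (-M)) ∂P :=
        integral_mono hψi (hEi.add (integrable_const _)) fun ω => gml_exp_trunc_le (F ω) M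
    _ = (∫ ω, Real.exp (F ω) ∂P) + Real.exp (-M) := by
        rw [integral_add hEi (integrable_const _), integral_const, probReal_univ, one_smul]
    _ ≤ 1 + Real.exp (-M) := by
        have hint : ∫ ω, Real.exp (F ω) ∂P ≤ 1 := by
          rw [integral_eq_lintegral_of_nonneg_ae (ae_of_all _ fun ω => (Real.exp_pos _).le) hEi.aestronglyMeasurable]
          exact ENNReal.toReal_le_of_le_ofReal zero_le_one (by rwa [ENNReal.ofReal_one])
        linarith

/-! ## Passing to the canonical local limit -/

/-- **THE MARKS OF A CANONICAL LOCAL LIMIT ARE MAXWELLIAN GIVEN THE POSITIONS, multiplicative form** (reference-side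
half of piece (P3) of the Gibbs-mixture wall). For `0 < σ ≤ 1/2`, `a, θ > 0`, a probability law `G` that is the
setwise local limit of the x-averaged blown-up canonical laws along `N`, a centred box `Λ_n`, a measurable `f` with
`∫ e^f dN(u₀, θI) ≤ 1` and `M ≥ 0`:
`∫ exp(max(min(F_{Λ_n}, M), -M)) d(windowLaw Λ_n G) ≤ 1 + e^{-M}`, `F_Λ(ω) = Σ_{(q,v) ∈ ω, q ∈ Λ} f(v)` (written as the
difference of the `ℝ≥0∞` window sums of `f⁺`, `f⁻`). The finite-`N` bound `gml_integral_exp_trunc_markSum_canonicalBlowUp_le`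
passes to the limit because the integrand is bounded and measurable and the window laws converge setwise. -/
theorem gml_integral_exp_trunc_markSum_windowLaw_le {σ a θ : ℝ} {u₀ : V3} (hσ : 0 < σ) (hσ2 : σ ≤ 1 / 2) (ha : 0 < a)
    (hθ : 0 < θ) {N : ℕ → ℕ}
    {Φ : ∀ k, HardSphereFlow (Literature.Analysis.FluidPDE.Torus.geometry (Fin 3)) (hsDiameter σ (N k)) (N k + 1)}
    {G : Measure (PointConfig (V3 × V3))} [IsProbabilityMeasure G] (hloc : IsCanonicalLocalLimit σ a θ u₀ N Φ G) (n : ℕ)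
    {f : V3 → ℝ} (hfm : Measurable f) (hf1 : ∫⁻ v, ENNReal.ofReal (Real.exp (f v)) ∂(gaussMeasure u₀ θ) ≤ 1) {M : ℝ}
    (hM : 0 ≤ M) :
    ∫ ω, Real.exp (max (min ((windowSum ω (centredBox n) (fun p => ENNReal.ofReal (f p.2))).toReal -
        (windowSum ω (centredBox n) (fun p => ENNReal.ofReal (-f p.2))).toReal) M) (-M)) ∂(windowLaw (centredBox n) G) ≤
      1 + Real.exp (-M) := by
  have hΛ : MeasurableSet (centredBox (d := Fin 3) n) := measurableSet_centredBox_fin3 n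
  haveI hP : ∀ k, IsProbabilityMeasure (canonicalBlowUpLaw σ a θ u₀ (N k) (Φ k)) := fun k => by
    unfold canonicalBlowUpLaw; exact isProbabilityMeasure_canonicalBlowUp u₀ hσ2 ha hθ (N k) (Φ k)
  haveI : ∀ k, IsProbabilityMeasure (windowLaw (centredBox n) (canonicalBlowUpLaw σ a θ u₀ (N k) (Φ k))) := fun k =>
    isProbabilityMeasure_windowLaw hΛ _
  haveI : IsProbabilityMeasure (windowLaw (centredBox n) G) := isProbabilityMeasure_windowLaw hΛ G
  have hlim := tendsto_integral_of_forall_tendsto_measure (R := fun k => windowLaw (centredBox n) (canonicalBlowUpLaw σ a θ u₀ (N k) (Φ k)))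
    (ν := windowLaw (centredBox n) G) (fun A hA => hloc _ hΛ (isBounded_centredBox n) A hA)
    (gml_measurable_exp_trunc_markSum hΛ hfm M) (C := Real.exp M) (fun ω => gml_abs_exp_trunc_le _ hM)
  exact le_of_tendsto' hlim fun k => gml_integral_exp_trunc_markSum_canonicalBlowUp_le u₀ hσ hσ2 ha hθ (N k) (Φ k) hΛ hfm hf1 M

end Summit.AtomisticToContinuum.HydrodynamicLimit.Theorems.KiferCompactification

end
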